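import Literature.MathematicalPhysics.QuantumFieldTheory.Balaban1983to89.B9Ineq363Vprime

/-!
# `Balaban1983to89.B9Ineq366Vprime` — B9 p. 403 (3.65)–(3.67) FOR THE CONCRETE `V′(A)` of (3.60): the bound (3.66) on
# `C′(A)` and «The inverse satisfies Theorem 3.2» — the `(Q′G′²Q′*)⁻¹`-clause of Theorem 3.4 — with `V′(A)` the concrete
# operator and `G′(U′U)` the concrete Neumann series (3.64), the (3.63)/(3.65)/Theorem-3.1-for-`G′(U′U)` inputs DISCHARGED

statement-level skeleton of published theorems with citation tags; proofs where landed; nothing here is a claim about the Yang–Mills mass gap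

DOCFIX (cell `lit-balaban`, seat r06 gen 15, 2026-08-22; p37 `CITELOC-SWEEP-B4B9.md` §2b page-numeral slips, text layer re-read): (3.57) is p. 401 [PDF 13] ((3.58)–(3.65) p. 402, (3.65)bis–(3.68) p. 403) — the locators of (3.57), (3.57)–(3.64), (3.57)–(3.65) in this file corrected accordingly (3 place(s)); declarations, statements and proofs byte-identical to the tree copy of record (p272277).

CITATION HEADER (lean-in-tree rule).  T. Bałaban, *Propagators for lattice gauge theories in a background field*, Commun.
Math. Phys. **99** (1985) 389–434 [Balaban1985BackgroundPropagators] (cell paper B9; `paper:balaban1985-cmp99-background-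
propagators`, journal page = PDF page + 388): p. 403 [PDF 15] (render `…-p015-x2.png` re-read as image by this seat,
2026-08-21; PRINT: «Let us consider the operator (Q′(U)G′²(U)Q′*(U))⁻¹. Its inverse can be analytically continued to
configurations U′U and has the expansion Q′(U′U)G′²(U′U)Q′*(U′U) = Q′(U)G′²(U)Q′*(U) + F′₂(A)G′²(U′U)Q′*(U) +
Q′(U)G′²(U′U)F′₂*(A) + F′₂(A)G′²(U′U)F′₂*(A) + Q′(U)G′(U′U)V′(A)G′²(U)Q′*(U) + Q′(U)G′²(U)V′(A)G′(U′U)Q′*(U) +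
Q′(U)G′(U)V′(A)G′²(U′U)V′(A)G′(U)Q′*(U) = Q′(U)G′²(U)Q′*(U) + C′(A), (3.65) where the operator C′(A) is defined by the last
equality. Using the results obtained for operators building it, and Lemma 2.1 [4], in the same way as in the bounds (2.68)
in [4], we get |C′(A; y, y′)| ≦ O(1)α₁(Lʲη)⁴(L^{j′}η)^{−d}e^{−(1/2)δ₀d(y,y′)} for y ∈ Λ_j, y′ ∈ Λ_{j′}. (3.66) Using Theorem
3.2 and the above bound we obtain Q′(U′U)G′²(U′U)Q′*(U′U) = (I + C′(A)(Q′(U)G′²(U)Q′*(U))⁻¹)·Q′(U)G′²(U)Q′*(U),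
|C′(A)(Q′(U)G′²(U)Q′*(Q))⁻¹)(y, y′)| ≦ O(1)α₁(L^{j′}η)^{−d}e^{−(1/2)δ₀d(y,y′)}, (3.67) thus the operators in the equality are
invertible and an inverse of the left-hand side can be expressed by a Neumann series convergent for α₁ sufficiently
small. Each term of the series is an analytic function of A on the domain (3.37). The inverse satisfies Theorem 3.2.»),
p. 402 [PDF 14] (3.57)–(3.65), p. 397–398 [PDF 9–10] Theorem 3.1 (3.42), Theorem 3.2 (3.48) and the remark «Using Lemma
2.1 in [4] we may replace the factor (Lʲη)^α by (Lʲη)^β(L^{j′}η)^γ», p. 400 [PDF 12] Theorem 3.4, p. 396 [PDF 8] (3.37);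
[4] = T. Bałaban, *Propagators and renormalization transformations for lattice gauge theories. II*, Commun. Math. Phys.
**96** (1984) 223–250 [Balaban1984PropagatorsII], Lemma 2.1 p. 234 ((2.60)–(2.61)), (2.51)–(2.55) p. 232, (2.66) p. 234,
(2.68) p. 235.  Cell `lit-balaban`, seat r06 (B9 fold owner) gen 9, fourth file; SKELETON rows **B9.Eq3.66** ((3.66)–(3.67)) ×
**B9.Thm3.4** (the `(Q′G′²Q′*)⁻¹`-clause) × B9.Eq3.62 × B9.Eq3.60.  DOCFIX v1.2 (r06 gen 16, 2026-08-22, DOC-ONLY; summit-lit1 g79 CITELOC, KNOWN-ROWED slip): [4] (2.66) is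
p. 234 (CMP 96, PDF p. 12: Lemma 2.1, (2.64)–(2.67)); (2.68) is p. 235 — locators corrected (3 places); no declaration, statement or proof touched.  Continuation BY NAME of this seat's `B9Ineq363Vprime`
(gen 9: `ineq363_op_vPrime` = (3.63) for the concrete `V′(A)`, `gpExt_entry1_vPrime` = (3.42)₁ for `G′(U′U)`,
`hasMajorant_vPrime_gpExt`, `theta363`, `cVConc`), `B9Eq360VprimeLetters` (gen 9: `vPrimeConc`), `B9Ineq366CPrime` (gen 6:
`cPrimeHom`, `kappa366`, `hasMajorant_cPrimeHom` = (3.66) for abstract two-space letters, `kappa366_pos`), of p06/r06's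
`B9Eq360Vprime` (`gPrimeExtEnd`, `eq365_end_left`, `eq365_end`, `opNorm_lt_one_of_363_261`, `sq_ext_expand`) and of
r06 gen 1's `B9Thm34Inv` (`inverse_satisfies_thm32` = (3.66) + (3.48) ⟹ (3.67) ⟹ the inverse obeys (3.48), `ker`, `vol`).

WHY.  `B9Ineq366CPrime` derived (3.66) and the inverse clause for ABSTRACT letters `G, E, V` carrying (3.42)₁-, (3.63)-
and (3.65)-SHAPED hypotheses (`hG`, `hE`, `hVG`, `hVE`, `h365l`, `h365r`).  Since gen 9 the tree has the CONCRETE `V′(A)`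
of (3.60) (`vPrimeConc`) with (3.63) proved (`ineq363_op_vPrime`), the concrete `G′(U′U) := gPrimeExtEnd G′ (V′G′)` of
(3.64) with (3.65) in both forms and (3.42)₁ proved (`gpExt_entry1_vPrime`), and the bootstrap letter `V′G′(U′U)` proved
(`hasMajorant_vPrime_gpExt`).  Feeding these into the abstract device gives (3.66) and «The inverse satisfies Theorem
3.2» for the concrete perturbation, with every `V′`/`G′(U′U)`-side input discharged down to Theorem 3.1 for `G′(U)`,
Theorem 3.2 for `(Q′G′²Q′*)⁻¹(U)`, (3.37) blockwise, the transports, the stencil geometry, the (3.19)/(3.58)/(3.24)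
kernel bounds of the averaging letters of `V′`, the two-space letters `Q′, Q′*, F′₂, F′₂*` with block-diagonal majorants,
and Lemma 2.1 of [4].

WHAT THIS FILE PROVES (0 sorry; theorems only; no `def`, no `def … : Prop`).
* §1 **`eq365b_hom`** — the p. 403 expansion `Q′(U′U)G′²(U′U)Q′*(U′U) = Q′(U)G′²(U)Q′*(U) + C′(A)` for TWO-SPACE letters
  `Q′, F′₂ : (sites) → (blocks)`, `Q′*, F′₂* : (blocks) → (sites)` (`C′(A) = B9Ineq366CPrime.cPrimeHom`), from (3.57)
  `Q′(U′U) = Q′(U) + F′₂(A)`, its adjoint and the two forms of (3.65) — the hetero twin of `B9Eq360Vprime.eq365b`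
  (there: all letters in one ring).
* §2 **`hasMajorant_cPrimeHom_vPrime`** — (3.66) FOR THE CONCRETE `V′(A)` AND THE CONCRETE `G′(U′U)`: the operator
  `C′(A)` on the block functions built from `Q′, F′₂, Q′*, F′₂*` (two-space letters with block-diagonal majorants
  `κ_Q𝟙`, `c_Fα₁𝟙`), `G′(U)` (Theorem 3.1 (3.42)₁,₂), `G′(U′U) := gPrimeExtEnd G′ (V′G′)` and `V′ = conj b (vPrimeConc …)` has
  the majorant `κ₃₆₆·α₁·(Lʲη)⁴·e^{−ρ d(y,y′)}` for every `ρ ≧ 0` with `ρ + (α+β)δ₀ ≦ (1−α′)ρ₁` (`ρ₁` the (3.63)-rate,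
  `ρ₁ + (α+β)δ₀ ≦ δ`), `κ₃₆₆ = kappa366 κ_Q c_F c_V B₀ B₁ Λ c₁(β) α₁` with `c_V = 2Λc₁(β)·cVConc` and
  `B₁ = B₀c₁(α′)(1 − θ₃₆₃c₁(α′))⁻¹` EXPLICIT — `B9Ineq366CPrime.hasMajorant_cPrimeHom` with `hG`/`hE`/`hVG`/`hVE` DISCHARGED;
  **`ineq366_kernel_vPrime`** — the same in the printed kernel notation `|C′(A;y,y′)| ≦ κ₃₆₆α₁(Lʲη)⁴(L^{j′}η)^{−d}e^{−ρd(y,y′)}`.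
* §3 **`inverse_satisfies_thm32_vPrime`** — «thus the operators in the equality are invertible … The inverse satisfies
  Theorem 3.2» FOR THE CONCRETE `V′(A)`: given in addition Theorem 3.2 (3.48) for a right inverse `Linv` of
  `L = Q′G′²(U)Q′*` on the block functions, the scale transfer of `(Lʲη)⁻⁴` at exponent `α_v ∈ (0, ½)` and (2.61) at
  `(δ₀, ½+α_v)` and `((½−α_v)δ₀, α₃)` (the inputs of `B9Thm34Inv.inverse_satisfies_thm32`), the rate condition
  `½δ₀ + (α+β)δ₀ ≦ (1−α′)ρ₁` and the EXPLICIT smallness `α₁ ≦ a₁ := (2κ₃₆₆B_ic₄c₁(δ₀,½+α_v)c₁((½−α_v)δ₀,α₃))⁻¹`: the operator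
  `L′ = Q′(U′U)G′²(U′U)Q′*(U′U)` (`Q′(U′U) = Q′ + F′₂`, `G′(U′U) = gPrimeExtEnd G′ (V′G′)`) has a two-sided inverse whose
  kernel obeys (3.48) with `B₁′ = 2B_ic₁((½−α_v)δ₀,α₃)`, `δ₁′ = (1−α₃)(½−α_v)δ₀`.

HONEST SCOPE / NOT CLAIMED.  (i) Theorem 3.1 for `G′(U)` ((3.42)₁ `h342_1` and (3.42)₂ per concrete difference letter
`h342_2`) and Theorem 3.2 for `U` (`hL`, `h348`) are INPUTS (p. 402 «We assume that Theorem 3.1 is valid for the operator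
G′(U)»; p. 403 «Using Theorem 3.2»); the two-space letters `Q′, Q′*, F′₂, F′₂*` enter with block-diagonal majorant
hypotheses of the (3.19)/(3.59) shape (the tree's `B9Eq319Avg.avgOp_hasMajorantHom_b9` supplies `Q′`'s literally; the
identification of `F′₂` with (3.58)–(3.59) is `B9Eq358Decomposition`/`B9Eq358KeyEstimate`, not repeated).  (ii) As in
`B9Eq360VprimeLetters`/`B9Ineq363Vprime`: the averaging kernels `kQ`, `kF`, `sQ`, `sF`, `c` of `V′` are parameters with
the (3.19)/(3.58)/(3.24) bounds as hypotheses; finite-dimensional `𝔸` with a real basis; (3.37) blockwise.  (iii) Rates: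
(3.66) comes out at any `ρ ≦ (1−α′)ρ₁ − (α+β)δ₀`; §3 uses it at `ρ = ½δ₀`, which REQUIRES `½δ₀ + (α+β)δ₀ ≦ (1−α′)ρ₁ ≦ δ −
(α+β)δ₀` — i.e. the Theorem-3.1 rate `δ` of the inputs must exceed `½δ₀` by the located Lemma-2.1 losses; with the
print's standing convention of re-defined constants (p. 403 l. 4–7) this is its «½δ₀»; the file does not hide the
condition.  (iv) «Each term of the series is an analytic function of A» is not treated (cf. `B9Eq386NeumannAnalytic`).
(v) Real block-sup model, kernels w.r.t. the pairing weight `(L^{j′}η)^d` (`B9Thm34Inv.ker (vol g d)`), as in all of the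
cell's B9 kernel modules.  Value = the `(Q′G′²Q′*)⁻¹`-clause of Theorem 3.4 kernel-checked for the concrete perturbation
`V′(A)` of (3.60); NOT summit progress.

RELATED IN THE TREE, NOT DUPLICATED (searched 2026-08-21: `lean search 'eq365b_hom|cPrimeHom_vPrime|thm32_vPrime'` = ∅;
`B9Ineq366CPrime.inverse_satisfies_thm32_of_parts` is the same clause for ABSTRACT one-carrier letters with (3.63)/(3.65)/
(3.42)₁-for-`E` as hypotheses, `B9Ineq366CPrime.hasMajorant_cPrimeHom`/`ineq366_kernel_hom` are (3.66) for abstract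
two-space letters — all USED here BY NAME with the `V′`/`G′(U′U)` inputs discharged; `B9Thm34Inv.inverse_satisfies_thm32`
is the (3.66)+(3.48) ⟹ (3.67) ⟹ inverse device, USED BY NAME).
-/

noncomputable section

namespace Literature.MathematicalPhysics.QuantumFieldTheory.Balaban1983to89.B9Ineq366Vprime

open Literature.MathematicalPhysics.QuantumFieldTheory.Balaban1983to89
open Literature.MathematicalPhysics.QuantumFieldTheory.Balaban1983to89.B6RandomWalk (HasMajorant hasMajorant_mono
  Triangle254 Ineq261)
open Literature.MathematicalPhysics.QuantumFieldTheory.Balaban1983to89.B6RandomWalkHom (HasMajorantHom)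
open Literature.MathematicalPhysics.QuantumFieldTheory.Balaban1983to89.B9Thm34Ext (toB6)
open Literature.MathematicalPhysics.QuantumFieldTheory.Balaban1983to89.B9Ineq347 (ScaleTransfer)
open Literature.MathematicalPhysics.QuantumFieldTheory.Balaban1983to89.B9Eq39Adjoint (covDstar)
open Literature.MathematicalPhysics.QuantumFieldTheory.Balaban1983to89.B9Ineq385VG (kappa385 kappa385_nonneg)
open Literature.MathematicalPhysics.QuantumFieldTheory.Balaban1983to89.B9Eq360Vprime (gPrimeExtEnd eq365_end_left
  eq365_end opNorm_lt_one_of_363_261 sq_ext_expand)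
open Literature.MathematicalPhysics.QuantumFieldTheory.Balaban1983to89.B9Eq352DivForm (tauB)
open Literature.MathematicalPhysics.QuantumFieldTheory.Balaban1983to89.B9Eq352DivFormLetters (conj)
open Literature.MathematicalPhysics.QuantumFieldTheory.Balaban1983to89.B9Eq352GradLetters (diffLetter)
open Literature.MathematicalPhysics.QuantumFieldTheory.Balaban1983to89.B9Eq360VprimeLetters (vPrimeConc)
open Literature.MathematicalPhysics.QuantumFieldTheory.Balaban1983to89.B9Ineq363Vprime (cVConc theta363 cVConc_nonneg
  theta363_nonneg ineq363_op_vPrime gpExt_entry1_vPrime hasMajorant_vPrime_gpExt)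
open Literature.MathematicalPhysics.QuantumFieldTheory.Balaban1983to89.B9Ineq366CPrime (cPrimeHom kappa366 kappa366_pos
  hasMajorant_cPrimeHom)
open Literature.MathematicalPhysics.QuantumFieldTheory.Balaban1983to89.B9Thm34Inv (ker vol)

/-! ## §1  The p. 403 expansion for two-space letters -/

section Algebra

variable {X Y : Type}

/-- **The p. 403 expansion (printed under the label (3.65)), two-space letters**: with (3.57) `Q′(U′U) = Q′(U) + F′₂(A)`,
`Q′*(U′U) = Q′*(U) + F′₂*(A)` and both forms of (3.65) for `E = G′(U′U)`,
`Q′(U′U)G′²(U′U)Q′*(U′U) = Q′(U)G′²(U)Q′*(U) + C′(A)` where `C′(A)` is the printed six-term sum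
(`B9Ineq366CPrime.cPrimeHom`), for `Q′, F′₂ : (X → ℝ) → (Y → ℝ)` and `Q′*, F′₂* : (Y → ℝ) → (X → ℝ)`.
[cite: Balaban1985BackgroundPropagators, (3.57) p.401 + (3.65)–(3.66) p.403] -/
theorem eq365b_hom (Q Q' F₂ : (X → ℝ) →ₗ[ℝ] (Y → ℝ)) (Qs Qs' F₂s : (Y → ℝ) →ₗ[ℝ] (X → ℝ))
    (G E V : Module.End ℝ (X → ℝ)) (h357 : Q' = Q + F₂) (h357s : Qs' = Qs + F₂s)
    (h365l : E = G + G * V * E) (h365r : E = G + E * V * G) :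
    Q' ∘ₗ (E * E) ∘ₗ Qs' = Q ∘ₗ (G * G) ∘ₗ Qs + cPrimeHom Q F₂ Qs F₂s G E V := by
  have hsq := sq_ext_expand G E V h365l h365r
  -- expand the two outer factors first, then the square in the `Q … Qs` term only
  have h1 : Q' ∘ₗ (E * E) ∘ₗ Qs'
      = Q ∘ₗ (E * E) ∘ₗ Qs + F₂ ∘ₗ (E * E) ∘ₗ Qs + Q ∘ₗ (E * E) ∘ₗ F₂s + F₂ ∘ₗ (E * E) ∘ₗ F₂s := by
    rw [h357, h357s]
    simp only [LinearMap.add_comp, LinearMap.comp_add]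
    abel
  have h2 : Q ∘ₗ (E * E) ∘ₗ Qs
      = Q ∘ₗ (G * G) ∘ₗ Qs + Q ∘ₗ (E * V * (G * G)) ∘ₗ Qs + Q ∘ₗ (G * G * V * E) ∘ₗ Qs
        + Q ∘ₗ (G * V * (E * E) * V * G) ∘ₗ Qs := by
    conv_lhs => rw [hsq]
    simp only [Module.End.mul_eq_comp, LinearMap.add_comp, LinearMap.comp_add]
  rw [h1, h2, cPrimeHom]
  abel

end Algebra

/-! ## §2  (3.66) for the concrete `V′(A)` and the concrete `G′(U′U)` -/

section Concrete

variable {𝔸 : Type*} [NormedRing 𝔸] [NormedAlgebra ℂ 𝔸] [CompleteSpace 𝔸] {ι : Type} [Fintype ι] [DecidableEq ι]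
variable (b : Module.Basis ι ℝ 𝔸) {S : Type} [Fintype S] [DecidableEq S] {κ : Type} [Fintype κ]
variable (T : κ → Equiv.Perm S) (U : κ → S → 𝔸ˣ)
variable {g : B9.Geometry} [Fintype g.Site] [DecidableEq g.Site] {Rr : ℝ} {H : Prop}

omit [Fintype g.Site] [DecidableEq g.Site] in
/-- Rate weakening `e^{−r d} ≦ e^{−ρ d}` for `ρ ≦ r`, `d ≧ 0`. [cite: Balaban1984PropagatorsII, (2.51) p.232] -/
private theorem exp_rate_le {ρ r dd : ℝ} (h : ρ ≤ r) (hd : 0 ≤ dd) : Real.exp (-(r * dd)) ≤ Real.exp (-(ρ * dd)) :=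
  Real.exp_le_exp.mpr (by nlinarith)

/-- `θ₃₆₃ = c_V·α₁·B₀` with `c_V := κ₃₈₅(1, cVConc, 0, 0, Λ, c) = 2Λc·cVConc` — the (3.63)-constant is linear in `B₀`.
[cite: Balaban1985BackgroundPropagators, (3.63) p.402] -/
theorem theta363_eq_cV (d : ℕ) (ρu α₁ a₀ C M₂ Sb E₀ B₀ Λ c : ℝ) :
    theta363 d ρu α₁ a₀ C M₂ Sb E₀ B₀ Λ c = kappa385 1 (cVConc d ρu α₁ a₀ C M₂ Sb E₀) 0 0 Λ c * α₁ * B₀ := by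
  unfold theta363 kappa385
  ring

/-- **(3.66) FOR THE CONCRETE `V′(A)` AND THE CONCRETE `G′(U′U)`**, block-majorant form of [4] (2.51) — «Using the results
obtained for operators building it, and Lemma 2.1 [4], in the same way as in the bounds (2.68) in [4], we get
|C′(A; y, y′)| ≦ O(1)α₁(Lʲη)⁴(L^{j′}η)^{−d}e^{−(1/2)δ₀d(y,y′)}»: with `V′ := conj b (vPrimeConc T U η A …)` (the concrete (3.60)),
`E := gPrimeExtEnd G′ (V′G′)` (the Neumann series (3.64)), two-space letters `Q′, F′₂ : (T_η-functions) → (𝔅-functions)`,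
`Q′*, F′₂*` back, with block-diagonal majorants `κ_Q𝟙[y=y′]`, `c_Fα₁𝟙[y=y′]` ((3.19), (3.59)), Theorem 3.1 (3.42)₁,₂ for
`G′(U)` at rate `δ`, the concrete-`V′` data ((3.37) blockwise, transports, stencil geometry, averaging kernel bounds),
Lemma 2.1 of [4] (transfers of `Lʲη`, `(Lʲη)²` at `α`, (2.61) at `(δ₀, β)` and `(ρ₁, α′)`), rates `ρ₁ + (α+β)δ₀ ≦ δ`,
`ρ + (α+β)δ₀ ≦ (1−α′)ρ₁`, smallness `θ₃₆₃c₁(α′) < 1`: the operator `C′(A)` (`cPrimeHom Q′ F′₂ Q′* F′₂* G′ E V′`) has the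
majorant `κ₃₆₆·α₁·(Lʲη)⁴·e^{−ρd(y,y′)}` for the identity block map, `κ₃₆₆ = kappa366 κ_Q c_F c_V B₀ B₁ Λ c₁(β) α₁`,
`c_V = κ₃₈₅(1, cVConc, 0, 0, Λ, c₁(β))`, `B₁ = B₀c₁(α′)(1 − θ₃₆₃c₁(α′))⁻¹` — `B9Ineq366CPrime.hasMajorant_cPrimeHom` with
`hG`, `hE` (`gpExt_entry1_vPrime`), `hVG` (`ineq363_op_vPrime`), `hVE` (`hasMajorant_vPrime_gpExt`) DISCHARGED.
[cite: Balaban1985BackgroundPropagators, (3.65)–(3.66) p.403 + (3.57)–(3.64) pp.401–402 + (3.42) p.397 + (3.19) p.393 + (3.37) p.396; Balaban1984PropagatorsII, Lemma 2.1 p.234 + (2.51)–(2.55) p.232 + (2.66) p.234] -/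
theorem hasMajorant_cPrimeHom_vPrime (blk : S → g.Site) (d : ℕ) {η : ℝ} (hη : 0 < η) (A : κ → S → 𝔸)
    (kQ kF : g.Site → S → 𝔸 →L[ℝ] 𝔸) (sQ sF : S → 𝔸 →L[ℝ] 𝔸) (c w : g.Site → ℝ) (ρu d₀ M₂ C a₀ : ℝ)
    (δ₀ δ α β ρ₁ ρ Λ B₀ α₁ α' κQ cF : ℝ)
    (hB₀ : 0 ≤ B₀) (hα₁ : 0 ≤ α₁) (hΛ : 0 ≤ Λ) (hρ₁ : 0 ≤ ρ₁) (hρ : 0 ≤ ρ) (hα : 0 ≤ α) (hβ : 0 ≤ β) (hδ₀ : 0 ≤ δ₀)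
    (hδ : 0 ≤ δ) (hκQ : 0 ≤ κQ) (hcF : 0 ≤ cF)
    (hr1 : ρ₁ + (α + β) * δ₀ ≤ δ) (hα'0 : 0 ≤ α') (hα'1 : α' ≤ 1) (hr : ρ + (α + β) * δ₀ ≤ (1 - α') * ρ₁)
    (hdnn : ∀ a a' : g.Site, 0 ≤ g.dist a a') (hrefl : ∀ y : g.Site, g.dist y y = 0)
    (htri : Triangle254 (toB6 g Rr H)) (hlen : ∀ y : g.Site, 0 < g.len y)
    (h261 : Ineq261 d (toB6 g Rr H) δ₀ β) (h261' : Ineq261 d (toB6 g Rr H) ρ₁ α')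
    (hT1 : ScaleTransfer g δ₀ α Λ (fun a => g.len a)) (hT2 : ScaleTransfer g δ₀ α Λ (fun a => g.len a ^ 2))
    -- the concrete `V′`-letters
    (hM₂ : 0 ≤ M₂) (hrepr : ∀ (v : 𝔸) (i : ι), |b.repr v i| ≤ M₂ * ‖v‖)
    (hsmall : ∀ y : g.Site, η * (α₁ * (g.len y)⁻¹) ≤ 1 / 4)
    (hA : ∀ μ x, ‖A μ x‖ ≤ α₁ * (g.len (blk x))⁻¹ ∧ ‖tauB T U μ (A μ) x‖ ≤ α₁ * (g.len (blk x))⁻¹)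
    (h337s : ∀ μ x, ‖((η : ℂ)⁻¹) • covDstar T U μ (A μ) x‖ ≤ α₁ * (g.len (blk x) ^ 2)⁻¹)
    (hρu : ∀ μ x, ‖((U μ x : 𝔸ˣ) : 𝔸)‖ ≤ ρu ∧ ‖(((U μ x)⁻¹ : 𝔸ˣ) : 𝔸)‖ ≤ ρu)
    (hd₀ : ∀ μ x, g.dist (blk x) (blk (T μ x)) ≤ d₀ ∧ g.dist (blk x) (blk ((T μ).symm x)) ≤ d₀)
    (hd₀0 : ∀ y : g.Site, g.dist y y ≤ d₀)
    (hw : ∀ y, 0 ≤ w y) (hcard : ∀ y, ((B9Eq360Vprime.block blk y).card : ℝ) * w y ≤ 1) (hC : 0 ≤ C) (ha₀ : 0 ≤ a₀)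
    (hkQ : ∀ y x, blk x = y → ‖kQ y x‖ ≤ w y) (hkF : ∀ y x, blk x = y → ‖kF y x‖ ≤ C * α₁ * w y)
    (hsQ : ∀ x, ‖sQ x‖ ≤ 1) (hsF : ∀ x, ‖sF x‖ ≤ C * α₁) (hc : ∀ y, |c y| ≤ a₀ * (g.len y ^ 2)⁻¹)
    -- the smallness condition («for α₁ sufficiently small»)
    (hθ : theta363 (Fintype.card κ) ρu α₁ a₀ C M₂ (∑ i, ‖b i‖) (Real.exp (δ * d₀)) B₀ Λ (B6.c1 d δ₀ β) *
      B6.c1 d ρ₁ α' < 1)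
    -- Theorem 3.1 for `G′(U)` and the two-space letters
    {Gp : Module.End ℝ (S × ι → ℝ)}
    (h342_1 : HasMajorant (g := toB6 g Rr H) (fun p : S × ι => blk p.1) Gp
      (fun a a' => B₀ * g.len a ^ 2 * Real.exp (-(δ * g.dist a a'))))
    (h342_2 : ∀ k : κ ⊕ κ, HasMajorant (g := toB6 g Rr H) (fun p : S × ι => blk p.1)
      (conj b (diffLetter T U ((η : ℂ)⁻¹) k) * Gp) (fun a a' => B₀ * g.len a * Real.exp (-(δ * g.dist a a'))))
    {Q F₂ : (S × ι → ℝ) →ₗ[ℝ] (g.Site → ℝ)} {Qs F₂s : (g.Site → ℝ) →ₗ[ℝ] (S × ι → ℝ)}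
    (hQ : HasMajorantHom (g := toB6 g Rr H) (fun p : S × ι => blk p.1) (fun y : g.Site => y) Q
      (fun a a' : g.Site => κQ * (if a = a' then (1 : ℝ) else 0)))
    (hQs : HasMajorantHom (g := toB6 g Rr H) (fun y : g.Site => y) (fun p : S × ι => blk p.1) Qs
      (fun a a' : g.Site => κQ * (if a = a' then (1 : ℝ) else 0)))
    (hF : HasMajorantHom (g := toB6 g Rr H) (fun p : S × ι => blk p.1) (fun y : g.Site => y) F₂
      (fun a a' : g.Site => cF * α₁ * (if a = a' then (1 : ℝ) else 0)))
    (hFs : HasMajorantHom (g := toB6 g Rr H) (fun y : g.Site => y) (fun p : S × ι => blk p.1) F₂s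
      (fun a a' : g.Site => cF * α₁ * (if a = a' then (1 : ℝ) else 0))) :
    let V := conj b (vPrimeConc T U η A blk kQ kF sQ sF c)
    let E := gPrimeExtEnd Gp (V * Gp)
    let θ := theta363 (Fintype.card κ) ρu α₁ a₀ C M₂ (∑ i, ‖b i‖) (Real.exp (δ * d₀)) B₀ Λ (B6.c1 d δ₀ β)
    let c' := B6.c1 d ρ₁ α'
    let cV := kappa385 1 (cVConc (Fintype.card κ) ρu α₁ a₀ C M₂ (∑ i, ‖b i‖) (Real.exp (δ * d₀))) 0 0 Λ (B6.c1 d δ₀ β)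
    HasMajorant (g := toB6 g Rr H) (fun y : g.Site => y) (cPrimeHom Q F₂ Qs F₂s Gp E V)
      (fun a a' => kappa366 κQ cF cV B₀ (B₀ * c' * (1 - θ * c')⁻¹) Λ (B6.c1 d δ₀ β) α₁ * α₁ * g.len a ^ 4 *
        Real.exp (-(ρ * g.dist a a'))) := by
  intro V E θ c' cV
  have hSb : 0 ≤ ∑ i, ‖b i‖ := Finset.sum_nonneg fun i _ => norm_nonneg _
  have hθ0 : 0 ≤ θ :=
    theta363_nonneg hα₁ ha₀ hC hM₂ hSb (Real.exp_nonneg _) hB₀ hΛ (B6RandomWalk.c1_nonneg d δ₀ β)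
  have hc'0 : 0 ≤ c' := B6RandomWalk.c1_nonneg d ρ₁ α'
  have hB₁ : 0 ≤ B₀ * c' * (1 - θ * c')⁻¹ := mul_nonneg (mul_nonneg hB₀ hc'0) (inv_nonneg.mpr (by linarith))
  have hcV0 : 0 ≤ cV :=
    kappa385_nonneg zero_le_one (cVConc_nonneg hα₁ ha₀ hC hM₂ hSb (Real.exp_nonneg _)) le_rfl le_rfl hΛ
      (B6RandomWalk.c1_nonneg d δ₀ β)
  have hθeq : θ = cV * α₁ * B₀ := theta363_eq_cV _ _ _ _ _ _ _ _ _ _ _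
  -- rates: r₀ := (1 − α′)ρ₁ ≤ ρ₁ ≤ δ
  have hα'ρ : 0 ≤ (1 - α') * ρ₁ := mul_nonneg (by linarith) hρ₁
  have hr₀ρ₁ : (1 - α') * ρ₁ ≤ ρ₁ := by nlinarith
  have hρ₁δ : ρ₁ ≤ δ := by
    have : 0 ≤ (α + β) * δ₀ := by positivity
    linarith
  have hr₀δ : (1 - α') * ρ₁ ≤ δ := hr₀ρ₁.trans hρ₁δ
  -- the four decaying inputs of `hasMajorant_cPrimeHom`, at the common rate r₀
  have hG : HasMajorant (g := toB6 g Rr H) (fun p : S × ι => blk p.1) Gp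
      (fun a a' => B₀ * g.len a ^ 2 * Real.exp (-((1 - α') * ρ₁ * g.dist a a'))) :=
    hasMajorant_mono (g := toB6 g Rr H) _ h342_1 fun a a' =>
      mul_le_mul_of_nonneg_left (exp_rate_le hr₀δ (hdnn a a')) (mul_nonneg hB₀ (sq_nonneg _))
  have hE : HasMajorant (g := toB6 g Rr H) (fun p : S × ι => blk p.1) E
      (fun a a' => B₀ * c' * (1 - θ * c')⁻¹ * g.len a ^ 2 * Real.exp (-((1 - α') * ρ₁ * g.dist a a'))) :=
    gpExt_entry1_vPrime b T U blk d hη A kQ kF sQ sF c w ρu d₀ M₂ C a₀ δ₀ δ α β ρ₁ Λ B₀ α₁ α' hB₀ hα₁ hΛ hρ₁ hα hβ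
      hδ₀ hδ hr1 hα'ρ hα'1 hdnn hrefl htri hlen h261 h261' hT1 hT2 hM₂ hrepr hsmall hA h337s hρu hd₀ hd₀0 hw hcard hC
      ha₀ hkQ hkF hsQ hsF hc hθ h342_1 h342_2
  have hVG : HasMajorant (g := toB6 g Rr H) (fun p : S × ι => blk p.1) (V * Gp)
      (fun a a' => cV * α₁ * B₀ * Real.exp (-((1 - α') * ρ₁ * g.dist a a'))) := by
    have h := ineq363_op_vPrime b T U blk d hη A kQ kF sQ sF c w ρu d₀ M₂ C a₀ δ₀ δ α β ρ₁ Λ B₀ α₁ hB₀ hα₁ hΛ hρ₁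
      hα hβ hδ₀ hδ hr1 hdnn htri hlen h261 hT1 hT2 hM₂ hrepr hsmall hA h337s hρu hd₀ hd₀0 hw hcard hC ha₀ hkQ hkF hsQ
      hsF hc h342_1 h342_2
    refine hasMajorant_mono (g := toB6 g Rr H) _ h fun a a' => ?_
    rw [show theta363 (Fintype.card κ) ρu α₁ a₀ C M₂ (∑ i, ‖b i‖) (Real.exp (δ * d₀)) B₀ Λ (B6.c1 d δ₀ β) = θ
      from rfl, hθeq]
    exact mul_le_mul_of_nonneg_left (exp_rate_le hr₀ρ₁ (hdnn a a')) (mul_nonneg (mul_nonneg hcV0 hα₁) hB₀)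
  have hVE : HasMajorant (g := toB6 g Rr H) (fun p : S × ι => blk p.1) (V * E)
      (fun a a' => cV * α₁ * (B₀ * c' * (1 - θ * c')⁻¹) * Real.exp (-((1 - α') * ρ₁ * g.dist a a'))) := by
    have h := hasMajorant_vPrime_gpExt b T U blk d hη A kQ kF sQ sF c w ρu d₀ M₂ C a₀ δ₀ δ α β ρ₁ Λ B₀ α₁ α' hB₀ hα₁
      hΛ hρ₁ hα hβ hδ₀ hδ hr1 hα'ρ hα'1 hdnn hrefl htri hlen h261 h261' hT1 hT2 hM₂ hrepr hsmall hA h337s hρu hd₀ hd₀0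
      hw hcard hC ha₀ hkQ hkF hsQ hsF hc hθ h342_1 h342_2
    refine hasMajorant_mono (g := toB6 g Rr H) _ h fun a a' => le_of_eq ?_
    rw [show theta363 (Fintype.card κ) ρu α₁ a₀ C M₂ (∑ i, ‖b i‖) (Real.exp (δ * d₀)) B₀ Λ (B6.c1 d δ₀ β) = θ
      from rfl, show B6.c1 d ρ₁ α' = c' from rfl, hθeq]
    ring
  exact hasMajorant_cPrimeHom (R := Rr) (H := H) (fun p : S × ι => blk p.1) d δ₀ ((1 - α') * ρ₁) α β ρ Λ κQ cF cV
    B₀ (B₀ * c' * (1 - θ * c')⁻¹) α₁ hκQ hcF hcV0 hB₀ hB₁ hα₁ hΛ hρ (mul_nonneg hα hδ₀) (mul_nonneg hβ hδ₀) hr hdnn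
    htri hT2 h261 hQ hQs hF hFs hG hE hVG hVE

/-- **(3.66) FOR THE CONCRETE `V′(A)`, printed kernel notation**: `|C′(A;y,y′)| ≦ κ₃₆₆α₁(Lʲη)⁴(L^{j′}η)^{−d}e^{−ρ d(y,y′)}`
for the kernel of `C′(A)` with respect to the pairing weight `(L^{j′}η)^d` (`B9Thm34Inv.ker (vol g d)`), hypotheses as
in `hasMajorant_cPrimeHom_vPrime`. [cite: Balaban1985BackgroundPropagators, (3.66) p.403] -/
theorem ineq366_kernel_vPrime (blk : S → g.Site) (d : ℕ) {η : ℝ} (hη : 0 < η) (A : κ → S → 𝔸)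
    (kQ kF : g.Site → S → 𝔸 →L[ℝ] 𝔸) (sQ sF : S → 𝔸 →L[ℝ] 𝔸) (c w : g.Site → ℝ) (ρu d₀ M₂ C a₀ : ℝ)
    (δ₀ δ α β ρ₁ ρ Λ B₀ α₁ α' κQ cF : ℝ)
    (hB₀ : 0 ≤ B₀) (hα₁ : 0 ≤ α₁) (hΛ : 0 ≤ Λ) (hρ₁ : 0 ≤ ρ₁) (hρ : 0 ≤ ρ) (hα : 0 ≤ α) (hβ : 0 ≤ β) (hδ₀ : 0 ≤ δ₀)
    (hδ : 0 ≤ δ) (hκQ : 0 ≤ κQ) (hcF : 0 ≤ cF)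
    (hr1 : ρ₁ + (α + β) * δ₀ ≤ δ) (hα'0 : 0 ≤ α') (hα'1 : α' ≤ 1) (hr : ρ + (α + β) * δ₀ ≤ (1 - α') * ρ₁)
    (hdnn : ∀ a a' : g.Site, 0 ≤ g.dist a a') (hrefl : ∀ y : g.Site, g.dist y y = 0)
    (htri : Triangle254 (toB6 g Rr H)) (hlen : ∀ y : g.Site, 0 < g.len y)
    (h261 : Ineq261 d (toB6 g Rr H) δ₀ β) (h261' : Ineq261 d (toB6 g Rr H) ρ₁ α')
    (hT1 : ScaleTransfer g δ₀ α Λ (fun a => g.len a)) (hT2 : ScaleTransfer g δ₀ α Λ (fun a => g.len a ^ 2))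
    (hM₂ : 0 ≤ M₂) (hrepr : ∀ (v : 𝔸) (i : ι), |b.repr v i| ≤ M₂ * ‖v‖)
    (hsmall : ∀ y : g.Site, η * (α₁ * (g.len y)⁻¹) ≤ 1 / 4)
    (hA : ∀ μ x, ‖A μ x‖ ≤ α₁ * (g.len (blk x))⁻¹ ∧ ‖tauB T U μ (A μ) x‖ ≤ α₁ * (g.len (blk x))⁻¹)
    (h337s : ∀ μ x, ‖((η : ℂ)⁻¹) • covDstar T U μ (A μ) x‖ ≤ α₁ * (g.len (blk x) ^ 2)⁻¹)
    (hρu : ∀ μ x, ‖((U μ x : 𝔸ˣ) : 𝔸)‖ ≤ ρu ∧ ‖(((U μ x)⁻¹ : 𝔸ˣ) : 𝔸)‖ ≤ ρu)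
    (hd₀ : ∀ μ x, g.dist (blk x) (blk (T μ x)) ≤ d₀ ∧ g.dist (blk x) (blk ((T μ).symm x)) ≤ d₀)
    (hd₀0 : ∀ y : g.Site, g.dist y y ≤ d₀)
    (hw : ∀ y, 0 ≤ w y) (hcard : ∀ y, ((B9Eq360Vprime.block blk y).card : ℝ) * w y ≤ 1) (hC : 0 ≤ C) (ha₀ : 0 ≤ a₀)
    (hkQ : ∀ y x, blk x = y → ‖kQ y x‖ ≤ w y) (hkF : ∀ y x, blk x = y → ‖kF y x‖ ≤ C * α₁ * w y)
    (hsQ : ∀ x, ‖sQ x‖ ≤ 1) (hsF : ∀ x, ‖sF x‖ ≤ C * α₁) (hc : ∀ y, |c y| ≤ a₀ * (g.len y ^ 2)⁻¹)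
    (hθ : theta363 (Fintype.card κ) ρu α₁ a₀ C M₂ (∑ i, ‖b i‖) (Real.exp (δ * d₀)) B₀ Λ (B6.c1 d δ₀ β) *
      B6.c1 d ρ₁ α' < 1)
    {Gp : Module.End ℝ (S × ι → ℝ)}
    (h342_1 : HasMajorant (g := toB6 g Rr H) (fun p : S × ι => blk p.1) Gp
      (fun a a' => B₀ * g.len a ^ 2 * Real.exp (-(δ * g.dist a a'))))
    (h342_2 : ∀ k : κ ⊕ κ, HasMajorant (g := toB6 g Rr H) (fun p : S × ι => blk p.1)
      (conj b (diffLetter T U ((η : ℂ)⁻¹) k) * Gp) (fun a a' => B₀ * g.len a * Real.exp (-(δ * g.dist a a'))))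
    {Q F₂ : (S × ι → ℝ) →ₗ[ℝ] (g.Site → ℝ)} {Qs F₂s : (g.Site → ℝ) →ₗ[ℝ] (S × ι → ℝ)}
    (hQ : HasMajorantHom (g := toB6 g Rr H) (fun p : S × ι => blk p.1) (fun y : g.Site => y) Q
      (fun a a' : g.Site => κQ * (if a = a' then (1 : ℝ) else 0)))
    (hQs : HasMajorantHom (g := toB6 g Rr H) (fun y : g.Site => y) (fun p : S × ι => blk p.1) Qs
      (fun a a' : g.Site => κQ * (if a = a' then (1 : ℝ) else 0)))
    (hF : HasMajorantHom (g := toB6 g Rr H) (fun p : S × ι => blk p.1) (fun y : g.Site => y) F₂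
      (fun a a' : g.Site => cF * α₁ * (if a = a' then (1 : ℝ) else 0)))
    (hFs : HasMajorantHom (g := toB6 g Rr H) (fun y : g.Site => y) (fun p : S × ι => blk p.1) F₂s
      (fun a a' : g.Site => cF * α₁ * (if a = a' then (1 : ℝ) else 0))) :
    let V := conj b (vPrimeConc T U η A blk kQ kF sQ sF c)
    let E := gPrimeExtEnd Gp (V * Gp)
    let θ := theta363 (Fintype.card κ) ρu α₁ a₀ C M₂ (∑ i, ‖b i‖) (Real.exp (δ * d₀)) B₀ Λ (B6.c1 d δ₀ β)
    let c' := B6.c1 d ρ₁ α'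
    let cV := kappa385 1 (cVConc (Fintype.card κ) ρu α₁ a₀ C M₂ (∑ i, ‖b i‖) (Real.exp (δ * d₀))) 0 0 Λ (B6.c1 d δ₀ β)
    ∀ y y' : g.Site,
      |ker (vol g d) (cPrimeHom Q F₂ Qs F₂s Gp E V) y y'| ≤
        kappa366 κQ cF cV B₀ (B₀ * c' * (1 - θ * c')⁻¹) Λ (B6.c1 d δ₀ β) α₁ * α₁ * g.len y ^ 4 *
          g.len y' ^ (-(d : ℝ)) * Real.exp (-(ρ * g.dist y y')) := by
  intro V E θ c' cV y y'
  have hM := hasMajorant_cPrimeHom_vPrime b T U blk d hη A kQ kF sQ sF c w ρu d₀ M₂ C a₀ δ₀ δ α β ρ₁ ρ Λ B₀ α₁ α' κQ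
    cF hB₀ hα₁ hΛ hρ₁ hρ hα hβ hδ₀ hδ hκQ hcF hr1 hα'0 hα'1 hr hdnn hrefl htri hlen h261 h261' hT1 hT2 hM₂ hrepr hsmall
    hA h337s hρu hd₀ hd₀0 hw hcard hC ha₀ hkQ hkF hsQ hsF hc hθ h342_1 h342_2 hQ hQs hF hFs
  have hent := (B9Thm34Inv.hasMajorant_id_iff (R := Rr) (H := H) _ _).mp hM y y'
  have hk := (B9Thm34Inv.ker_le_iff (vol g d) (B9Thm34Inv.vol_pos d hlen y') _ y _).mpr hent
  rw [B9Thm34Inv.vol_inv d hlen] at hk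
  calc |ker (vol g d) (cPrimeHom Q F₂ Qs F₂s Gp E V) y y'|
      ≤ kappa366 κQ cF cV B₀ (B₀ * c' * (1 - θ * c')⁻¹) Λ (B6.c1 d δ₀ β) α₁ * α₁ * g.len y ^ 4 *
          Real.exp (-(ρ * g.dist y y')) * g.len y' ^ (-(d : ℝ)) := hk
    _ = _ := by ring

/-! ## §3  «The inverse satisfies Theorem 3.2» for the concrete `V′(A)` -/

/-- **B9 p. 403 «thus the operators in the equality are invertible and an inverse of the left-hand side can be expressed
by a Neumann series convergent for α₁ sufficiently small. … The inverse satisfies Theorem 3.2» — the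
`(Q′G′²Q′*)⁻¹`-CLAUSE OF THEOREM 3.4 FOR THE CONCRETE `V′(A)` of (3.60) and the concrete `G′(U′U)` of (3.64).**
Data and inputs: the concrete-`V′` data and Theorem 3.1 (3.42)₁,₂ for `G′(U)` as in `hasMajorant_cPrimeHom_vPrime`; the
two-space letters `Q′, Q′*, F′₂, F′₂*` with block-diagonal majorants `κ_Q𝟙`, `c_Fα₁𝟙` ((3.19), (3.59)); (3.57)
`Q′(U′U) = Q′ + F′₂`, `Q′*(U′U) = Q′* + F′₂*`; THEOREM 3.2 for `U`: a right inverse `Linv` of `L = Q′G′²(U)Q′*` on the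
functions on 𝔅 (`hL`) whose kernel obeys (3.48) `|Linv(y,y′)| ≦ B_i(Lʲη)⁻⁴(L^{j′}η)^{−d}e^{−δ₀d(y,y′)}` (`h348`); Lemma 2.1
of [4]: the scale transfer of the p. 398 remark for `(Lʲη)⁻⁴` at exponent `α_v ∈ (0, ½)` with constant `c₄`, (2.61) at
`(δ₀, ½+α_v)` and at `((½−α_v)δ₀, α₃)`, `α₃ < 1` (the inputs of `B9Thm34Inv.inverse_satisfies_thm32`); the RATE
CONDITION `½δ₀ + (α+β)δ₀ ≦ (1−α′)ρ₁` (so that (3.66) holds at the printed `½δ₀`); the smallness `θ₃₆₃c₁(α′) < 1` and —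
in the conclusion's premise — the EXPLICIT threshold `α₁ ≦ a₁ := (2κ₃₆₆B_ic₄c₁(δ₀,½+α_v)·c₁((½−α_v)δ₀,α₃))⁻¹`.
CONCLUSION: `L′ = Q′(U′U)G′²(U′U)Q′*(U′U)` with `G′(U′U) = gPrimeExtEnd G′ (V′G′)` has a two-sided inverse `T` on the block
functions with `|T(y,y′)| ≦ 2B_ic₁((½−α_v)δ₀,α₃)(Lʲη)⁻⁴(L^{j′}η)^{−d}e^{−(1−α₃)(½−α_v)δ₀d(y,y′)}` — (3.48) at `U′U` with the
constants `B₁′ = 2B_ic₁`, `δ₁′ = (1−α₃)(½−α_v)δ₀` of `B9Thm34Inv`, now resting on Theorems 3.1/3.2 for `U` (printed-shape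
hypotheses), the two-space letters, the concrete `V′(A)` and Lemma 2.1 only: `B9Thm34Inv.inverse_satisfies_thm32` with
`h365` := `eq365b_hom` (from (3.57) and the two forms of (3.65) for the concrete `E`, `B9Eq360Vprime.eq365_end_left`/
`eq365_end`, available since ‖V′G′‖ < 1 by (3.63) = `ineq363_op_vPrime`) and `h366` := `ineq366_kernel_vPrime` at `ρ = ½δ₀`.
[cite: Balaban1985BackgroundPropagators, Thm 3.2 (3.48) p.398 + (3.57)–(3.65) pp.401–402 + (3.65)–(3.67) p.403 + Thm 3.4 p.400 + (3.42) p.397; Balaban1984PropagatorsII, Lemma 2.1 p.234 + (2.51)–(2.55) p.232 + (2.66) p.234] -/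
theorem inverse_satisfies_thm32_vPrime (blk : S → g.Site) (d : ℕ) {η : ℝ} (hη : 0 < η) (A : κ → S → 𝔸)
    (kQ kF : g.Site → S → 𝔸 →L[ℝ] 𝔸) (sQ sF : S → 𝔸 →L[ℝ] 𝔸) (c w : g.Site → ℝ) (ρu d₀ M₂ C a₀ : ℝ)
    (δ₀ δ α β ρ₁ Λ B₀ α₁ α' κQ cF αv α₃ c₄ Bi : ℝ)
    (hB₀ : 0 < B₀) (hα₁ : 0 ≤ α₁) (hΛ : 0 < Λ) (hρ₁ : 0 ≤ ρ₁) (hα : 0 ≤ α) (hβ : 0 ≤ β) (hδ₀ : 0 < δ₀)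
    (hδ : 0 ≤ δ) (hκQ : 0 < κQ) (hcF : 0 < cF) (hαv0 : 0 < αv) (hαv : αv < 1 / 2) (hα₃ : α₃ < 1) (hc₄ : 0 < c₄)
    (hBi : 0 < Bi)
    (hr1 : ρ₁ + (α + β) * δ₀ ≤ δ) (hα'0 : 0 ≤ α') (hα'1 : α' ≤ 1) (hr : δ₀ / 2 + (α + β) * δ₀ ≤ (1 - α') * ρ₁)
    (hc₁ : 0 < B6.c1 d δ₀ (1 / 2 + αv)) (hc₁' : 0 < B6.c1 d ((1 / 2 - αv) * δ₀) α₃) (hc₂ : 0 < B6.c1 d δ₀ β)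
    (hc' : 0 < B6.c1 d ρ₁ α')
    (hdnn : ∀ a a' : g.Site, 0 ≤ g.dist a a') (hrefl : ∀ y : g.Site, g.dist y y = 0)
    (hsym : ∀ y y' : g.Site, g.dist y y' = g.dist y' y)
    (htri : Triangle254 (toB6 g Rr H)) (hlen : ∀ y : g.Site, 0 < g.len y)
    (h261 : Ineq261 d (toB6 g Rr H) δ₀ β) (h261' : Ineq261 d (toB6 g Rr H) ρ₁ α')
    (h261v : Ineq261 d (toB6 g Rr H) δ₀ (1 / 2 + αv)) (h261v' : Ineq261 d (toB6 g Rr H) ((1 / 2 - αv) * δ₀) α₃)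
    (hT1 : ScaleTransfer g δ₀ α Λ (fun a => g.len a)) (hT2 : ScaleTransfer g δ₀ α Λ (fun a => g.len a ^ 2))
    (hT4 : ScaleTransfer g δ₀ αv c₄ (fun y => g.len y ^ (-(4 : ℝ))))
    -- the concrete `V′`-letters
    (hM₂ : 0 ≤ M₂) (hrepr : ∀ (v : 𝔸) (i : ι), |b.repr v i| ≤ M₂ * ‖v‖)
    (hsmall : ∀ y : g.Site, η * (α₁ * (g.len y)⁻¹) ≤ 1 / 4)
    (hA : ∀ μ x, ‖A μ x‖ ≤ α₁ * (g.len (blk x))⁻¹ ∧ ‖tauB T U μ (A μ) x‖ ≤ α₁ * (g.len (blk x))⁻¹)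
    (h337s : ∀ μ x, ‖((η : ℂ)⁻¹) • covDstar T U μ (A μ) x‖ ≤ α₁ * (g.len (blk x) ^ 2)⁻¹)
    (hρu : ∀ μ x, ‖((U μ x : 𝔸ˣ) : 𝔸)‖ ≤ ρu ∧ ‖(((U μ x)⁻¹ : 𝔸ˣ) : 𝔸)‖ ≤ ρu)
    (hd₀ : ∀ μ x, g.dist (blk x) (blk (T μ x)) ≤ d₀ ∧ g.dist (blk x) (blk ((T μ).symm x)) ≤ d₀)
    (hd₀0 : ∀ y : g.Site, g.dist y y ≤ d₀)
    (hw : ∀ y, 0 ≤ w y) (hcard : ∀ y, ((B9Eq360Vprime.block blk y).card : ℝ) * w y ≤ 1) (hC : 0 ≤ C) (ha₀ : 0 ≤ a₀)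
    (hkQ : ∀ y x, blk x = y → ‖kQ y x‖ ≤ w y) (hkF : ∀ y x, blk x = y → ‖kF y x‖ ≤ C * α₁ * w y)
    (hsQ : ∀ x, ‖sQ x‖ ≤ 1) (hsF : ∀ x, ‖sF x‖ ≤ C * α₁) (hc : ∀ y, |c y| ≤ a₀ * (g.len y ^ 2)⁻¹)
    -- the first smallness condition («for α₁ sufficiently small»: ‖V′G′‖ < 1)
    (hθ : theta363 (Fintype.card κ) ρu α₁ a₀ C M₂ (∑ i, ‖b i‖) (Real.exp (δ * d₀)) B₀ Λ (B6.c1 d δ₀ β) *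
      B6.c1 d ρ₁ α' < 1)
    -- Theorem 3.1 for `G′(U)`, the two-space letters, (3.57), Theorem 3.2 for `U`
    {Gp : Module.End ℝ (S × ι → ℝ)}
    (h342_1 : HasMajorant (g := toB6 g Rr H) (fun p : S × ι => blk p.1) Gp
      (fun a a' => B₀ * g.len a ^ 2 * Real.exp (-(δ * g.dist a a'))))
    (h342_2 : ∀ k : κ ⊕ κ, HasMajorant (g := toB6 g Rr H) (fun p : S × ι => blk p.1)
      (conj b (diffLetter T U ((η : ℂ)⁻¹) k) * Gp) (fun a a' => B₀ * g.len a * Real.exp (-(δ * g.dist a a'))))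
    {Q Q' F₂ : (S × ι → ℝ) →ₗ[ℝ] (g.Site → ℝ)} {Qs Qs' F₂s : (g.Site → ℝ) →ₗ[ℝ] (S × ι → ℝ)}
    (h357 : Q' = Q + F₂) (h357s : Qs' = Qs + F₂s)
    (hQ : HasMajorantHom (g := toB6 g Rr H) (fun p : S × ι => blk p.1) (fun y : g.Site => y) Q
      (fun a a' : g.Site => κQ * (if a = a' then (1 : ℝ) else 0)))
    (hQs : HasMajorantHom (g := toB6 g Rr H) (fun y : g.Site => y) (fun p : S × ι => blk p.1) Qs
      (fun a a' : g.Site => κQ * (if a = a' then (1 : ℝ) else 0)))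
    (hF : HasMajorantHom (g := toB6 g Rr H) (fun p : S × ι => blk p.1) (fun y : g.Site => y) F₂
      (fun a a' : g.Site => cF * α₁ * (if a = a' then (1 : ℝ) else 0)))
    (hFs : HasMajorantHom (g := toB6 g Rr H) (fun y : g.Site => y) (fun p : S × ι => blk p.1) F₂s
      (fun a a' : g.Site => cF * α₁ * (if a = a' then (1 : ℝ) else 0)))
    {Linv : Module.End ℝ (g.Site → ℝ)} (hL : (Q ∘ₗ (Gp * Gp) ∘ₗ Qs) * Linv = 1)
    (h348 : ∀ y y' : g.Site, |ker (vol g d) Linv y y'| ≤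
      Bi * g.len y ^ (-(4 : ℝ)) * g.len y' ^ (-(d : ℝ)) * Real.exp (-(δ₀ * g.dist y y'))) :
    let V := conj b (vPrimeConc T U η A blk kQ kF sQ sF c)
    let E := gPrimeExtEnd Gp (V * Gp)
    let θ := theta363 (Fintype.card κ) ρu α₁ a₀ C M₂ (∑ i, ‖b i‖) (Real.exp (δ * d₀)) B₀ Λ (B6.c1 d δ₀ β)
    let c' := B6.c1 d ρ₁ α'
    let cV := kappa385 1 (cVConc (Fintype.card κ) ρu α₁ a₀ C M₂ (∑ i, ‖b i‖) (Real.exp (δ * d₀))) 0 0 Λ (B6.c1 d δ₀ β)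
    let κ₆ := kappa366 κQ cF cV B₀ (B₀ * c' * (1 - θ * c')⁻¹) Λ (B6.c1 d δ₀ β) α₁
    α₁ ≤ (2 * (κ₆ * Bi * c₄ * B6.c1 d δ₀ (1 / 2 + αv)) * B6.c1 d ((1 / 2 - αv) * δ₀) α₃)⁻¹ →
      ∃ Tinv : Module.End ℝ (g.Site → ℝ),
        Tinv * (Q' ∘ₗ (E * E) ∘ₗ Qs') = 1 ∧ (Q' ∘ₗ (E * E) ∘ₗ Qs') * Tinv = 1 ∧
          ∀ y y' : g.Site, |ker (vol g d) Tinv y y'| ≤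
            2 * Bi * B6.c1 d ((1 / 2 - αv) * δ₀) α₃ * g.len y ^ (-(4 : ℝ)) * g.len y' ^ (-(d : ℝ)) *
              Real.exp (-((1 - α₃) * ((1 / 2 - αv) * δ₀) * g.dist y y')) := by
  intro V E θ c' cV κ₆ ha₁
  have hSb : 0 ≤ ∑ i, ‖b i‖ := Finset.sum_nonneg fun i _ => norm_nonneg _
  have hθ0 : 0 ≤ θ :=
    theta363_nonneg hα₁ ha₀ hC hM₂ hSb (Real.exp_nonneg _) hB₀.le hΛ.le (B6RandomWalk.c1_nonneg d δ₀ β)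
  have hcV0 : 0 ≤ cV :=
    kappa385_nonneg zero_le_one (cVConc_nonneg hα₁ ha₀ hC hM₂ hSb (Real.exp_nonneg _)) le_rfl le_rfl hΛ.le
      (B6RandomWalk.c1_nonneg d δ₀ β)
  have hB₁ : 0 < B₀ * c' * (1 - θ * c')⁻¹ := mul_pos (mul_pos hB₀ hc') (inv_pos.mpr (by linarith))
  have hκ : 0 < κ₆ := kappa366_pos hκQ hcF hcV0 hB₁ hΛ hc₂ hα₁
  have hα'ρ : 0 ≤ (1 - α') * ρ₁ := mul_nonneg (by linarith) hρ₁
  -- (3.63) for the concrete V′ and ‖V′G′‖ < 1, hence the two forms of (3.65) for E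
  have h363 : HasMajorant (g := toB6 g Rr H) (fun p : S × ι => blk p.1) (V * Gp)
      (fun a a' => θ * Real.exp (-(ρ₁ * g.dist a a'))) :=
    ineq363_op_vPrime b T U blk d hη A kQ kF sQ sF c w ρu d₀ M₂ C a₀ δ₀ δ α β ρ₁ Λ B₀ α₁ hB₀.le hα₁ hΛ.le hρ₁ hα hβ
      hδ₀.le hδ hr1 hdnn htri hlen h261 hT1 hT2 hM₂ hrepr hsmall hA h337s hρu hd₀ hd₀0 hw hcard hC ha₀ hkQ hkF hsQ hsF
      hc h342_1 h342_2
  have hW : ‖B9Eq360Vprime.toCLM (V * Gp)‖ < 1 :=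
    opNorm_lt_one_of_363_261 (g := toB6 g Rr H) (fun p : S × ι => blk p.1) d ρ₁ α' θ hθ0 hα'ρ hdnn h261' hθ h363
  have h365l : E = Gp + Gp * V * E := eq365_end_left Gp V hW
  have h365r : E = Gp + E * V * Gp := by
    have h := eq365_end Gp (V * Gp) hW
    rwa [← mul_assoc] at h
  have h365 : Q' ∘ₗ (E * E) ∘ₗ Qs' = Q ∘ₗ (Gp * Gp) ∘ₗ Qs + cPrimeHom Q F₂ Qs F₂s Gp E V :=
    eq365b_hom Q Q' F₂ Qs Qs' F₂s Gp E V h357 h357s h365l h365r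
  -- (3.66) at the printed rate ½δ₀, in kernel notation with the real power (Lʲη)⁴
  have h366 := ineq366_kernel_vPrime b T U blk d hη A kQ kF sQ sF c w ρu d₀ M₂ C a₀ δ₀ δ α β ρ₁ (δ₀ / 2) Λ B₀ α₁ α'
    κQ cF hB₀.le hα₁ hΛ.le hρ₁ (by linarith) hα hβ hδ₀.le hδ hκQ.le hcF.le hr1 hα'0 hα'1 hr hdnn hrefl htri hlen h261
    h261' hT1 hT2 hM₂ hrepr hsmall hA h337s hρu hd₀ hd₀0 hw hcard hC ha₀ hkQ hkF hsQ hsF hc hθ h342_1 h342_2 hQ hQs hF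
    hFs
  have h366' : ∀ y y' : g.Site, |ker (vol g d) (cPrimeHom Q F₂ Qs F₂s Gp E V) y y'| ≤
      κ₆ * α₁ * g.len y ^ (4 : ℝ) * g.len y' ^ (-(d : ℝ)) * Real.exp (-(δ₀ / 2 * g.dist y y')) := by
    intro y y'
    have h4 : g.len y ^ (4 : ℝ) = g.len y ^ 4 := by
      rw [show (4 : ℝ) = ((4 : ℕ) : ℝ) by norm_num, Real.rpow_natCast]
    rw [h4]
    exact h366 y y'
  exact B9Thm34Inv.inverse_satisfies_thm32 (R := Rr) (H := H) d δ₀ αv α₃ κ₆ Bi c₄ α₁ hδ₀ hαv0 hαv hα₃ hκ hBi hc₄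
    hα₁ hc₁ hc₁' htri hsym hrefl hdnn hlen hT4 h261v h261v' ha₁ hL h348 h365 h366'

end Concrete

end Literature.MathematicalPhysics.QuantumFieldTheory.Balaban1983to89.B9Ineq366Vprime

end
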